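import Summits.ResolutionOfSingularities.ResolutionOfSingularities.Theorems.MarkedTransferCampaignW13CanonicalFeedsProof
import Literature.Barriers.ResolutionOfSingularities.NarasimhanMaximalContact
import Mathlib.RingTheory.MvPolynomial.Ideal
import HarnessLib

/-!
# [OURS · L1 W1.3] REFUTATION of the rung-1 content Prop on the canonical class: `¬ CampaignW13RFlatCanonicalPos 2 K x`
# at NARASIMHAN's head `x² + yz³ + zw³ + y⁷w` (p = 2) — the canonical tail misses the top locus (seat res-L1-s13-pv-1, g2)

LADDER-RESOLUTION rung L (rescue), cell `res-hironaka`, RESCUE-SEED slot W1.3 (architecture bypass, reading R-flat), F7′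
consumer table rows 1 / 2(b) (director-resolution 2026-08-27T01:05:24Z (1), 01:55:25Z (b2″)). The content Prop typed by
res-L1-type-o2 (p483384 `MarkedTransferCampaignW13CanonicalFeeds.lean`, OURS-DESK #68 lanes A/B YES·YES):
`Campaign.CampaignW13RFlatCanonicalPos p K y` = «every CANONICAL chain datum (head `x_y^q + ε`, `ε` free of `x_y`, tail
`x_y + r`, knock-out `ε − r^q` without `q`-th-power monomials) keeps its tail under R-flat: `tail^q ∈ ℘_alg((g), q)(1)`».
Its docstring names the KILL LINE: «one arc-certified canonical chain with `tail^q ∉ ℘_alg(Ě,1)`». This file lands that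
arc certificate, and it is the catalogued barrier `Literature.Barriers.ResolutionOfSingularities.NarasimhanMaximalContact`
(Kollár 2007 Aside 3.57 / Hauser 2003 §14 Ex. 1 / Narasimhan 1983) read through the slot's own arc criterion (p481686
`W13.not_mem_pAlgPiece_one_of_arc`).

THE MECHANISM (new, general; §1). For the hypersurface model `Ě = ((g), 2)` over a field `K` and ANY ring map
`φ : K[x_σ] → K[t]` with `φ(g) = 0` and `φ(∂_i g) = 0` for all `i` — an ARC INSIDE THE ORDER-`≥ 2` LOCUS `top(g)` — every
element of the bound algebraic `℘(Ě,1)` (`Campaign.pAlgPiece K (g) 2 1`, row 003 U17_2: degree-1 piece of the integral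
closure of `O[(g)X², Diff^{(1)}((g))X]`) is killed by `φ` (`map_eq_zero_of_mem_pAlgPiece_one`): the Diff-subalgebra maps to
`K[t] ⊂ K[t][X]`, over which nothing of positive `X`-degree is integral. Hence every `c` with `s·c^n ∈ ℘(Ě,1)`, `φ(s) ≠ 0`,
`n ≥ 1`, vanishes along the arc (`map_eq_zero_of_mul_pow_mem_pAlgPiece_one`). NECESSARY CONDITION for rows 1 / 2(b) of the
F7′ table at a chain: THE TAIL MUST VANISH ON EVERY ARC OF `top(g)` — the failure locus of the R-flat feed contains every head
whose top locus through `ξ` leaves the tail hypersurface, also after localisation at `ξ` (the multiplier `s`).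

THE WITNESS (§2–§3). Narasimhan's `f = x² + ε`, `ε = yz³ + zw³ + y⁷w ∈ K[y,z,w]`, `char K = 2` (tree `narasimhanPoly`,
variables `0 ↦ x, 1 ↦ y, 2 ↦ z, 3 ↦ w`): `ε` is free of `x`, has NO square monomial (`y¹z³`, `z¹w³`, `y⁷w¹`) and `ord₀ ε = 4 >
q = 2` — so the datum (head `f`, `e = 1`, tail `x`, `r = 0`) IS CANONICAL (`narasimhan_isCanonicalChain`; clause (83)(1)
«`ord ε(0) > q`» also holds). The monomial curve `C : t ↦ (t³², t⁷, t¹⁹, t¹⁵)` lies in `top(f)` (tree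
`aeval_curve_narasimhanPoly`, `aeval_curve_pderiv_narasimhanPoly`) and `x∘C = t³² ≠ 0`. Hence `x² ∉ ℘_alg(((f),2),1)`
(`narasimhan_tail_sq_not_mem`), also `s·x² ∉ ℘` for every `s` with `s(0) ≠ 0` (`narasimhan_mul_tail_sq_not_mem`: the
STALK-LEVEL repair fails too), `¬ RFlatTailPow`, and **`¬ CampaignW13RFlatCanonicalPos 2 K (0 : Fin 4)` for every field `K`
of characteristic 2** (`Campaign.not_CampaignW13RFlatCanonicalPos`). CLASSIFICATION: refuted-SUBSTANTIVE for the class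
`𝒞_can` — not a missing side condition: by the tree's semigroup lemma `linearPart_eq_zero_of_aeval_curve_eq_zero` NO element
vanishing on `C` has a linear part, so no coordinate change / no other choice of a regular tail repairs it (Narasimhan: `top(f)`
lies in no smooth hypersurface).

CONSEQUENCE FOR ROW 2(b) (§4). For EVERY level `e` and EVERY module `𝔏₀(∞)` the bound R-flat cotangent module
`Cot_flat = bypassCotRFlat e L0inf ℘_alg(((f),2),1)` (v2/v3 of `MarkedTransferCampaignW13Bypass.lean`) lies in `𝔪₀²`
(`narasimhan_bypassCotRFlat_le_msq`): it has NO cotangential generator at Narasimhan's point, `rank Cot_flat/(Cot_flat ∩ 𝔪²)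
= 0`, so the (125)-feed `CampaignW13Eq125Flat e L0inf P1 𝔪₀ V` FAILS for every cotangent datum `V` containing an element with
a linear part, in particular for `V ∋ x` (`narasimhan_not_CampaignW13Eq125Flat`). Row 2(a) (`Cot_flat ⊆ √I(Sing)`, PROVED
p483887) is exactly the property that empties row 2(b) here. VERDICT WORDS for the slot (prover's, AI bookkeeping weaker than
expert review): rows 1 and 2(b) of F7′ CANNOT be re-fed from the R-flat slot at Narasimhan's point; by the director's kill
line 2026-08-27T01:05:24Z (1) W1.3 is DEAD AS A §13 REPLACEMENT on any class containing this head, alive as the banked R-flat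
theorems (A/B/C/D/R2/E2, `𝒞_Diff`). RESCUE-SEED's caveat is untouched and restated: nothing here bears on L-G4 / (127)
(`KangarooShadeIncrease`).

HONEST FRAMING. Nothing here is a statement of H. Hironaka's manuscript [Hironaka2017] (2017-03-23, lit key
`paper:url-3343fd9e678b`); the objects are OURS (bypass reading R-flat, `℘` bound algebraic, row 003 U17_2; the
identification with the geometric `℘`, candidate U17_4, is NOT used). Whether the manuscript's own `Cot(Ě)` (with `℘nega`)
contains the tail `x` at Narasimhan's point while vanishing on `Sing(Ě)` (Th 14.2 (108) vs Th 15.9 p.79 L16–L19) is a question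
for the adjudication desk (GAP rows R01/R08), recorded here only as a question. AI computation is weaker than expert review;
nothing here is progress on resolution of singularities in positive characteristic. All decls `[folklore]` (elementary algebra
over the cited barrier), sorry-free.
-/

noncomputable section

set_option linter.dupNamespace false -- mandated namespace of this single-conjunct summit

namespace Summit.ResolutionOfSingularities.ResolutionOfSingularities.Theorems.Campaign

open MvPolynomial
open Literature.AlgebraicGeometry.Hironaka2017
open Literature.AlgebraicGeometry.Hironaka2017.S11CoordFree (BlSub)
open Literature.AlgebraicGeometry.Hironaka2017.S09LLUED (LLChainData)
open Literature.Barriers.ResolutionOfSingularities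

universe u

namespace W13

/-! ## §1 Arcs inside the top locus kill `℘(((g),2), 1)` -/

section SingArc

variable (K : Type u) [Field K] {σ : Type} [Fintype σ]

/-- **Singular-arc criterion.** If a ring map `φ : K[x_σ] → K[t]` kills `g` and all `∂_i g` (an arc inside the order-`≥ 2`
locus of `g`), then every `c` with `φ(c) ≠ 0` lies OUTSIDE the bound algebraic `℘(((g),2),1)` — p481686's arc criterion with
`θ = t^{deg φ(c) + 1}`, which divides `φ(∂_i g) = 0` and does not divide `φ(c)`. [folklore] -/
theorem not_mem_pAlgPiece_one_of_singArc (φ : MvPolynomial σ K →+* Polynomial K) (g : MvPolynomial σ K)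
    (hg : φ g = 0) (hd : ∀ i, φ (pderiv i g) = 0) {c : MvPolynomial σ K} (hc : φ c ≠ 0) :
    c ∉ Campaign.pAlgPiece K (Ideal.span {g}) 2 1 := by
  refine not_mem_pAlgPiece_one_of_arc K φ (θ := (Polynomial.X : Polynomial K) ^ ((φ c).natDegree + 1))
    (pow_ne_zero _ Polynomial.X_ne_zero) g hg (fun i => ?_) ?_
  · rw [hd i]; exact dvd_zero _
  · intro h
    have h1 := Polynomial.natDegree_le_of_dvd h hc
    rw [Polynomial.natDegree_X_pow] at h1
    omega

/-- Contrapositive: `℘(((g),2),1)` lies in the ideal of every arc of the top locus — every element of the bound algebraic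
`℘(Ě,1)` vanishes along `φ`. [folklore] -/
theorem map_eq_zero_of_mem_pAlgPiece_one (φ : MvPolynomial σ K →+* Polynomial K) (g : MvPolynomial σ K)
    (hg : φ g = 0) (hd : ∀ i, φ (pderiv i g) = 0) {c : MvPolynomial σ K}
    (hc : c ∈ Campaign.pAlgPiece K (Ideal.span {g}) 2 1) : φ c = 0 := by
  by_contra h
  exact not_mem_pAlgPiece_one_of_singArc K φ g hg hd h hc

/-- Cotangent / stalk form: if `s·c^n ∈ ℘(((g),2),1)` with `φ(s) ≠ 0` (e.g. `s(ξ) ≠ 0` for an arc through `ξ`) and `n ≥ 1`,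
then `c` vanishes along the arc. So a tail kept by ANY module inside `℘(Ě,1)` — even after localising at `ξ` — must vanish
on every arc of `top(g)` through `ξ`. [folklore] -/
theorem map_eq_zero_of_mul_pow_mem_pAlgPiece_one (φ : MvPolynomial σ K →+* Polynomial K) (g : MvPolynomial σ K)
    (hg : φ g = 0) (hd : ∀ i, φ (pderiv i g) = 0) {s c : MvPolynomial σ K} {n : ℕ}
    (hmem : s * c ^ n ∈ Campaign.pAlgPiece K (Ideal.span {g}) 2 1) (hs : φ s ≠ 0) (hn : n ≠ 0) : φ c = 0 := by
  have h := map_eq_zero_of_mem_pAlgPiece_one K φ g hg hd hmem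
  rw [map_mul, map_pow] at h
  rcases mul_eq_zero.mp h with h | h
  · exact absurd h hs
  · exact (pow_eq_zero_iff hn).mp h

end SingArc

/-! ## §2 Narasimhan's head as a canonical chain datum, and the arc certificate -/

section Narasimhan

variable (K : Type) [Field K] [CharP K 2]

omit [CharP K 2] in
/-- Narasimhan's `f` IS a head `x² + ε` with `ε = yz³ + zw³ + y⁷w` (re-association of the tree's `narasimhanPoly`).
[folklore] -/
theorem narasimhanPoly_eq_head :
    narasimhanPoly K = X 0 ^ 2 + (X 1 * X 2 ^ 3 + X 2 * X 3 ^ 3 + X 1 ^ 7 * X 3) := by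
  rw [narasimhanPoly]; ring

omit [CharP K 2] in
/-- Support of a sum of three monomials. [folklore] -/
theorem support_monomial_add_three_subset (m₁ m₂ m₃ : Fin 4 →₀ ℕ) (c₁ c₂ c₃ : K) :
    (monomial m₁ c₁ + monomial m₂ c₂ + monomial m₃ c₃ : MvPolynomial (Fin 4) K).support ⊆ {m₁, m₂, m₃} := by
  intro m hm
  rw [Finset.mem_insert, Finset.mem_insert, Finset.mem_singleton]
  rcases Finset.mem_union.mp (support_add hm) with h | h
  · have h' := support_monomial_add_subset m₁ m₂ c₁ c₂ h
    rw [Finset.mem_insert, Finset.mem_singleton] at h'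
    rcases h' with h' | h'
    · exact Or.inl h'
    · exact Or.inr (Or.inl h')
  · exact Or.inr (Or.inr (Finset.mem_singleton.mp (support_monomial_subset h)))

omit [CharP K 2] in
/-- **Narasimhan's datum is CANONICAL** (`𝒞_can`, o2 p483384): head `f = x² + ε`, `e = 1`, tail `x`, `r = 0`; `ε` is free of
`x` and its three monomials `yz³`, `zw³`, `y⁷w` each carry an odd exponent (no square monomial: `ε` is `g`-cleaned and the
knock-out `ε − 0²` is `2`-power-free). [folklore] -/
theorem narasimhan_isCanonicalChain (d : LLChainData (MvPolynomial (Fin 4) K))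
    (hdg : d.g 0 = narasimhanPoly K) (hde : d.e = 1) (hdt : d.tail = X 0) :
    IsCanonicalChain 2 K (0 : Fin 4) d := by
  refine ⟨X 1 * X 2 ^ 3 + X 2 * X 3 ^ 3 + X 1 ^ 7 * X 3, 0, ?_, by simp, ?_, by rw [hdt, add_zero], ?_⟩
  · exact not_mem_vars_of_mem_supported (add_mem (add_mem
      (mul_mem ((X_mem_supported (R := K)).mpr (by decide)) (pow_mem ((X_mem_supported (R := K)).mpr (by decide)) 3))
      (mul_mem ((X_mem_supported (R := K)).mpr (by decide)) (pow_mem ((X_mem_supported (R := K)).mpr (by decide)) 3)))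
      (mul_mem (pow_mem ((X_mem_supported (R := K)).mpr (by decide)) 7) ((X_mem_supported (R := K)).mpr (by decide))))
  · rw [hdg, hde, pow_one, narasimhanPoly_eq_head]
  · rw [hde]
    intro m hm
    rw [pow_one, zero_pow two_ne_zero, sub_zero, X_pow_eq_monomial, X_pow_eq_monomial, X_pow_eq_monomial, X, X, X,
      monomial_mul, monomial_mul, monomial_mul] at hm
    have h := support_monomial_add_three_subset K _ _ _ _ _ _ hm
    rw [Finset.mem_insert, Finset.mem_insert, Finset.mem_singleton] at h
    rcases h with rfl | rfl | rfl
    · exact ⟨1, by rw [Finsupp.add_apply, Finsupp.single_eq_same, Finsupp.single_eq_of_ne (by decide)]; decide⟩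
    · exact ⟨2, by rw [Finsupp.add_apply, Finsupp.single_eq_same, Finsupp.single_eq_of_ne (by decide)]; decide⟩
    · exact ⟨3, by rw [Finsupp.add_apply, Finsupp.single_eq_of_ne (by decide), Finsupp.single_eq_same]; decide⟩

/-- **`℘(Ě,1) ⊆ I(C)`**: every element of the bound algebraic `℘(((f),2),1)` vanishes on Narasimhan's curve
`C : t ↦ (t³², t⁷, t¹⁹, t¹⁵) ⊆ top(f)` (§1 with the tree's `aeval_curve_narasimhanPoly`, `aeval_curve_pderiv_narasimhanPoly`).
[folklore] -/
theorem narasimhan_map_eq_zero_of_mem {c : MvPolynomial (Fin 4) K}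
    (hc : c ∈ Campaign.pAlgPiece K (Ideal.span {narasimhanPoly K}) 2 1) :
    aeval (narasimhanCurve K) c = 0 :=
  map_eq_zero_of_mem_pAlgPiece_one K (aeval (narasimhanCurve K)).toRingHom (narasimhanPoly K)
    (aeval_curve_narasimhanPoly K) (aeval_curve_pderiv_narasimhanPoly K) hc

/-- … hence (tree `linearPart_eq_zero_of_aeval_curve_eq_zero`, the semigroup argument) every element of `℘(((f),2),1)` has
ZERO constant and linear part: `℘(Ě,1) ⊆ 𝔪₀²`. [folklore] -/
theorem narasimhan_linearPart_eq_zero_of_mem {c : MvPolynomial (Fin 4) K}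
    (hc : c ∈ Campaign.pAlgPiece K (Ideal.span {narasimhanPoly K}) 2 1) :
    coeff 0 c = 0 ∧ ∀ i, coeff (Finsupp.single i 1) c = 0 :=
  linearPart_eq_zero_of_aeval_curve_eq_zero K c (narasimhan_map_eq_zero_of_mem K hc)

omit [CharP K 2] in
/-- The canonical tail evaluated on the curve: `x∘C = t³²`, and `(x²)∘C = t⁶⁴ ≠ 0`. [folklore] -/
theorem narasimhan_aeval_curve_tail_sq :
    aeval (narasimhanCurve K) (X 0 ^ 2 : MvPolynomial (Fin 4) K) = Polynomial.X ^ 64 ∧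
      (Polynomial.X ^ 64 : Polynomial K) ≠ 0 := by
  refine ⟨?_, pow_ne_zero _ Polynomial.X_ne_zero⟩
  rw [map_pow, aeval_X]
  simp only [narasimhanCurve, narasimhanExp_zero, ← pow_mul]

/-- **THE ARC CERTIFICATE (kill line K-a of the F7′ table): `x² ∉ ℘_alg(((f),2),1)`** for Narasimhan's head, `char K = 2` —
the canonical tail's square is NOT in the bound characteristic algebra's degree-1 piece, globally on `K[x,y,z,w]`.
[folklore] -/
theorem narasimhan_tail_sq_not_mem :
    (X 0 : MvPolynomial (Fin 4) K) ^ 2 ∉ Campaign.pAlgPiece K (Ideal.span {narasimhanPoly K}) 2 1 := by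
  refine not_mem_pAlgPiece_one_of_singArc K (aeval (narasimhanCurve K)).toRingHom (narasimhanPoly K)
    (aeval_curve_narasimhanPoly K) (aeval_curve_pderiv_narasimhanPoly K) ?_
  change aeval (narasimhanCurve K) (X 0 ^ 2 : MvPolynomial (Fin 4) K) ≠ 0
  rw [(narasimhan_aeval_curve_tail_sq K).1]
  exact (narasimhan_aeval_curve_tail_sq K).2

/-- **The STALK-LEVEL repair fails as well**: for every multiplier `s` with `s(0) ≠ 0` (a unit of `O_{𝔸⁴,0}`), `s·x² ∉
℘_alg(((f),2),1)` — because the curve `C` passes through the origin (`s∘C` has constant term `s(0)`). So `x² ∉ ℘(Ě,1)·O_{Z,ξ}`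
at `ξ = 0`: localising the typed (global) Prop at the singular point does not rescue it. [folklore] -/
theorem narasimhan_mul_tail_sq_not_mem (s : MvPolynomial (Fin 4) K) (hs : coeff 0 s ≠ 0) :
    s * X 0 ^ 2 ∉ Campaign.pAlgPiece K (Ideal.span {narasimhanPoly K}) 2 1 := by
  refine not_mem_pAlgPiece_one_of_singArc K (aeval (narasimhanCurve K)).toRingHom (narasimhanPoly K)
    (aeval_curve_narasimhanPoly K) (aeval_curve_pderiv_narasimhanPoly K) ?_
  change aeval (narasimhanCurve K) (s * X 0 ^ 2 : MvPolynomial (Fin 4) K) ≠ 0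
  have h0 : aeval (narasimhanCurve K) s ≠ 0 := by
    intro h
    have h1 := coeff_aeval_curve K s 0 0 narasimhanWeight_eq_zero_iff
    rw [h, Polynomial.coeff_zero] at h1
    exact hs h1.symm
  rw [map_mul, (narasimhan_aeval_curve_tail_sq K).1]
  exact mul_ne_zero h0 (narasimhan_aeval_curve_tail_sq K).2

/-- **`¬ RFlatTailPow`** (v4 schema) for every chain datum on Narasimhan's head with `e = 1` and the canonical tail `x`.
[folklore] -/
theorem narasimhan_not_rFlatTailPow (d : LLChainData (MvPolynomial (Fin 4) K))
    (hdg : d.g 0 = narasimhanPoly K) (hde : d.e = 1) (hdt : d.tail = X 0) :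
    ¬ Campaign.RFlatTailPow 2 K (Ideal.span {d.g 0}) (2 ^ d.e) d := by
  rw [Campaign.RFlatTailPow, hdg, hde, hdt, pow_one]
  exact narasimhan_tail_sq_not_mem K

end Narasimhan

end W13

/-! ## §3 The headline: the content Prop on `𝒞_can` is FALSE at `p = 2`, `σ = Fin 4`, tail variable `x = X 0` -/

section Headline

/-- **REFUTATION of `Campaign.CampaignW13RFlatCanonicalPos`** (o2 p483384, OURS-DESK #68) at `p = 2` over every field of
characteristic `2`, chart `K[x,y,z,w]`, tail variable `x`: Narasimhan's canonical datum (head `x² + yz³ + zw³ + y⁷w`,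
`e = 1`, tail `x`) violates `RFlatTailPow` (`W13.narasimhan_not_rFlatTailPow`). CLASS: refuted-SUBSTANTIVE for `𝒞_can` —
the canonical (coordinate-bound, junk-free) tail need not vanish on the top locus through `ξ`, and at this head NO
regular parameter does (barrier `NarasimhanMaximalContact`); the stalk-level variant fails too
(`W13.narasimhan_mul_tail_sq_not_mem`). What survives: POS on `𝒞_Diff` (p482051) and on A/B/C/D/R2/E2; the necessary
condition of §1 (tail vanishes on every arc of `top(g)` through `ξ`) as the failure-locus boundary. [folklore] -/
theorem not_CampaignW13RFlatCanonicalPos (K : Type) [Field K] [CharP K 2] :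
    ¬ CampaignW13RFlatCanonicalPos 2 K (0 : Fin 4) := by
  intro h
  have key : ∀ d : LLChainData (MvPolynomial (Fin 4) K), d.g 0 = narasimhanPoly K → d.e = 1 → d.tail = X 0 → False :=
    fun d hdg hde hdt =>
      W13.narasimhan_not_rFlatTailPow K d hdg hde hdt (h d (W13.narasimhan_isCanonicalChain K d hdg hde hdt))
  exact key ⟨1, fun _ => X 0, fun j => if j = 0 then narasimhanPoly K else X 0,
      fun _ => X 1 * X 2 ^ 3 + X 2 * X 3 ^ 3 + X 1 ^ 7 * X 3, fun _ => 0, fun _ => 4⟩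
    (by show (if (0 : ℕ) = 0 then narasimhanPoly K else (X 0 : MvPolynomial (Fin 4) K)) = narasimhanPoly K
        exact if_pos rfl)
    rfl
    (by show (if (1 : ℕ) = 0 then narasimhanPoly K else (X 0 : MvPolynomial (Fin 4) K)) = X 0
        exact if_neg one_ne_zero)

/-- The `𝔽₂` instance (the census field of j263239/j263697): `¬ CampaignW13RFlatCanonicalPos 2 (ZMod 2) (0 : Fin 4)`.
[folklore] -/
theorem not_CampaignW13RFlatCanonicalPos_zmod2 : ¬ CampaignW13RFlatCanonicalPos 2 (ZMod 2) (0 : Fin 4) :=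
  not_CampaignW13RFlatCanonicalPos (ZMod 2)

end Headline

/-! ## §4 Row 2(b) at Narasimhan's point: the R-flat cotangent module has NO cotangential generator -/

namespace W13

section Row2b

variable (K : Type) [Field K] [CharP K 2] {ℓ : ℕ}

/-- For EVERY level `e` and EVERY parameter `𝔏₀(∞)`: an element `φ` of the bound R-flat cotangent module
`Cot_flat = bypassCotRFlat e L0inf ℘_alg(((f),2),1)` (v2 `Campaign.bypassCotRFlat`, `P1` bound as in v3) at Narasimhan's head
has zero constant and linear part — since `φ^{2^e} ∈ ℘(Ě,1)` vanishes on the curve `C`, so does `φ`, and the semigroup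
lemma applies. [folklore] -/
theorem narasimhan_linearPart_eq_zero_of_mem_bypassCotRFlat (e : ℕ) (L0inf : BlSub (MvPolynomial (Fin 4) K) 2 ℓ)
    {φ : MvPolynomial (Fin 4) K}
    (hφ : φ ∈ bypassCotRFlat e L0inf (Campaign.pAlgPiece K (Ideal.span {narasimhanPoly K}) 2 1)) :
    coeff 0 φ = 0 ∧ ∀ i, coeff (Finsupp.single i 1) φ = 0 := by
  have h2 : φ ^ 2 ^ e ∈ Campaign.pAlgPiece K (Ideal.span {narasimhanPoly K}) 2 1 := by
    simpa only [iterateFrobenius_def] using ((mem_bypassCotRFlat_iff e L0inf _ φ).mp hφ).2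
  have h3 := narasimhan_map_eq_zero_of_mem K h2
  rw [map_pow] at h3
  exact linearPart_eq_zero_of_aeval_curve_eq_zero K φ ((pow_eq_zero_iff (pow_ne_zero e two_ne_zero)).mp h3)

/-- **`Cot_flat ⊆ 𝔪₀²`** at Narasimhan's point, for every `e` and `𝔏₀(∞)`: `rank Cot_flat/(Cot_flat ∩ 𝔪²) = 0` — the (125)
count of cotangential generators is ZERO for the bypass module (`𝔪₀ = idealOfVars`, the ideal of the origin). [folklore] -/
theorem narasimhan_bypassCotRFlat_le_msq (e : ℕ) (L0inf : BlSub (MvPolynomial (Fin 4) K) 2 ℓ)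
    {φ : MvPolynomial (Fin 4) K}
    (hφ : φ ∈ bypassCotRFlat e L0inf (Campaign.pAlgPiece K (Ideal.span {narasimhanPoly K}) 2 1)) :
    φ ∈ idealOfVars (Fin 4) K ^ 2 := by
  rw [mem_pow_idealOfVars_iff']
  intro x hx
  obtain ⟨hc, hl⟩ := narasimhan_linearPart_eq_zero_of_mem_bypassCotRFlat K e L0inf hφ
  rcases eq_zero_or_eq_single_of_degree_lt_two x hx with rfl | ⟨i, rfl⟩
  · exact hc
  · exact hl i

/-- No element with a linear part — in particular no regular parameter of `O_{𝔸⁴,0}` — lies in `Cot_flat` at Narasimhan's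
head, whatever `e` and `𝔏₀(∞)`. [folklore] -/
theorem narasimhan_not_mem_bypassCotRFlat_of_coeff (e : ℕ) (L0inf : BlSub (MvPolynomial (Fin 4) K) 2 ℓ)
    {φ : MvPolynomial (Fin 4) K} (i : Fin 4) (hφi : coeff (Finsupp.single i 1) φ ≠ 0) :
    φ ∉ bypassCotRFlat e L0inf (Campaign.pAlgPiece K (Ideal.span {narasimhanPoly K}) 2 1) :=
  fun h => hφi ((narasimhan_linearPart_eq_zero_of_mem_bypassCotRFlat K e L0inf h).2 i)

/-- The canonical tail `x` itself is NOT in `Cot_flat` (any `e`, any `𝔏₀(∞)`) — K1.3's «`Cot ∋ tails` UNCHANGED» (examples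
B/C/D) does not extend to Narasimhan's head. [folklore] -/
theorem narasimhan_tail_not_mem_bypassCotRFlat (e : ℕ) (L0inf : BlSub (MvPolynomial (Fin 4) K) 2 ℓ) :
    (X 0 : MvPolynomial (Fin 4) K) ∉ bypassCotRFlat e L0inf (Campaign.pAlgPiece K (Ideal.span {narasimhanPoly K}) 2 1) :=
  narasimhan_not_mem_bypassCotRFlat_of_coeff K e L0inf 0 (by rw [coeff_X, if_pos rfl]; exact one_ne_zero)

/-- **ROW 2(b) DEAD at Narasimhan's point**: the (125)-substitute feed `CampaignW13Eq125Flat e L0inf P1 𝔪₀ V` (o2 p483384: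
«every `v ∈ V` has a representative `φ ∈ Cot_flat` with `φ − v ∈ 𝔪²`») FAILS for the bound `P1 = ℘_alg(((f),2),1)`, every
`e`, every `𝔏₀(∞)`, and every cotangent datum `V` containing an element `v` with a non-zero linear coefficient (e.g. the LL
tail `x`): `φ ∈ 𝔪₀²`-up-to-constants forces `v`'s linear part to vanish. [folklore] -/
theorem narasimhan_not_CampaignW13Eq125Flat (e : ℕ) (L0inf : BlSub (MvPolynomial (Fin 4) K) 2 ℓ)
    (V : Set (MvPolynomial (Fin 4) K)) {v : MvPolynomial (Fin 4) K} (hv : v ∈ V) (i : Fin 4)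
    (hvi : coeff (Finsupp.single i 1) v ≠ 0) :
    ¬ CampaignW13Eq125Flat e L0inf (Campaign.pAlgPiece K (Ideal.span {narasimhanPoly K}) 2 1)
        (idealOfVars (Fin 4) K) V := by
  intro h
  obtain ⟨φ, hφ, hdiff⟩ := h v hv
  have h1 := (narasimhan_linearPart_eq_zero_of_mem_bypassCotRFlat K e L0inf hφ).2 i
  have h2 : coeff (Finsupp.single i 1) (φ - v) = 0 :=
    (mem_pow_idealOfVars_iff' 2 _).mp hdiff _ (by rw [Finsupp.degree_single]; norm_num)
  rw [coeff_sub, h1, zero_sub, neg_eq_zero] at h2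
  exact hvi h2

/-- Instance of record: `V = {x}` (the canonical tail as the cotangent datum), `𝔪 = 𝔪₀`: row 2(b)'s feed fails for every
`e` and `𝔏₀(∞)`. [folklore] -/
theorem narasimhan_not_CampaignW13Eq125Flat_tail (e : ℕ) (L0inf : BlSub (MvPolynomial (Fin 4) K) 2 ℓ) :
    ¬ CampaignW13Eq125Flat e L0inf (Campaign.pAlgPiece K (Ideal.span {narasimhanPoly K}) 2 1)
        (idealOfVars (Fin 4) K) {(X 0 : MvPolynomial (Fin 4) K)} :=
  narasimhan_not_CampaignW13Eq125Flat K e L0inf _ (Set.mem_singleton _) 0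
    (by rw [coeff_X, if_pos rfl]; exact one_ne_zero)

end Row2b

end W13

end Summit.ResolutionOfSingularities.ResolutionOfSingularities.Theorems.Campaign

end
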